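import Summits.HubbardSuperconductivity.HubbardSuperconductivity.Theorems.AnisotropyChordTransferFibre3N1RowObjB

/-!
# Route `AnisotropyChord` / H0 rotor rung, LEVEL 2 row `N₁`: the GENERIC PAIR-SUM REDUCTION over `T′ = 𝕋 ∖ {0, −x̂}`

The outer parts of the pair objects (`B̂` and, above all, `Ĵ₁ = B_C`-hat of part 4, `…N1RowExprJA`) are full sums over `T′` of
polynomials in `g = g(k)`, `g′ = g(k + x̂)`, `E = E(k)`, `E′ = E(k + x̂)` that are linear in `(E, E′)`.  After the pointwise
reduction `E g = 1 + λ₂g`, `E′g′ = 1 + λ₂g′` (off `0`, `−x̂`) such a polynomial is a `PairCoef` — sixteen coefficients on the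
monomials `1, g, g′, g², gg′, g′², g³, g²g′, gg′², g′³, E, Eg′, Eg′², E′, E′g, E′g²` — and its `T′`-sum is the explicit named
expression `PairCoef.red` (the two-propagator table `T10, G21, G12`, the one-propagator sums `S_j − g₁^j`, `|T′| = V − 2`,
`Σ_{T′} E = Σ_{T′} E′ = 4V − 2ε₁`, and `ShiftedEnergyReduction` + `CosWeightedReduction` for `Σ g′^jE = Σ g^jE′`, `j = 1, 2`,
the latter by the reflection `k ↦ −k − x̂` of `T′`).  ★ `sum_torPrime_pairCoef`.  This is the Lean form of the symbolic `Reducer`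
of the blueprint (bc_codegen.py); each of the five outer polynomials of `Ĵ₁` is then ONE `PairCoef` literal (`…N1RowObjJ*`).
Prover seat `hubbard-h0-rotor-p2` g5; helper for piece A = stmt-HubbardSuperconductivity-23918 of rung 19089
(`--supports`, helper class).  Nothing here proves superconductivity in the Hubbard model; helper lemmas of ONE conditional
reduction (the GM₃ ∀L certificate, Level-2 row `N₁`); the rotor TARGET as originally worded stays FALSE (g15 verdict).
Mathlib + the tree only; no sorry.
-/

set_option linter.dupNamespace false
set_option autoImplicit false

open Literature.Analysis.ValidatedNumerics

namespace Summit.HubbardSuperconductivity.HubbardSuperconductivity.Theorems.AnisotropyChord.Transfer.Fibre3.L2.N1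

variable (L : ℕ) [NeZero L] (lam2 : ℝ)

/-- coefficients of a reduced pair polynomial (linear in `E, E′`; see the module header for the monomial order). -/
structure PairCoef where
  /-- coefficient of `1` -/
  a00 : ℝ
  /-- of `g` -/
  a10 : ℝ
  /-- of `g′` -/
  a01 : ℝ
  /-- of `g²` -/
  a20 : ℝ
  /-- of `gg′` -/
  a11 : ℝ
  /-- of `g′²` -/
  a02 : ℝ
  /-- of `g³` -/
  a30 : ℝ
  /-- of `g²g′` -/
  a21 : ℝ
  /-- of `gg′²` -/
  a12 : ℝ
  /-- of `g′³` -/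
  a03 : ℝ
  /-- of `E` -/
  b0 : ℝ
  /-- of `Eg′` -/
  b1 : ℝ
  /-- of `Eg′²` -/
  b2 : ℝ
  /-- of `E′` -/
  c0 : ℝ
  /-- of `E′g` -/
  c1 : ℝ
  /-- of `E′g²` -/
  c2 : ℝ

/-- the value of the pair polynomial at `(g, g′, E, E′)`. -/
def PairCoef.eval (P : PairCoef) (g g' E E' : ℝ) : ℝ :=
  P.a00 + P.a10 * g + P.a01 * g' + P.a20 * g ^ 2 + P.a11 * (g * g') + P.a02 * g' ^ 2 + P.a30 * g ^ 3
    + P.a21 * (g ^ 2 * g') + P.a12 * (g * g' ^ 2) + P.a03 * g' ^ 3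
    + P.b0 * E + P.b1 * (E * g') + P.b2 * (E * g' ^ 2) + P.c0 * E' + P.c1 * (E' * g) + P.c2 * (E' * g ^ 2)

/-- `Σ_{T′} g(k + x̂)^j E(k)` in named form (`ShiftedEnergyReduction` with `CosWeightedReduction` substituted; `cos θ = 1 − ε₁`,
`sin²θ = 2ε₁ − ε₁²`), `j = 1, 2`. -/
noncomputable def serJ (j : ℕ) : ℝ :=
  let V : ℝ := (L : ℝ) ^ 2
  let ε := eps1 L
  let g1 := gres L lam2 (K1 L)
  let Sj := if j = 1 then S1n L lam2 else S2n L lam2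
  let Cj := if j = 1 then (1 - lam2 / 4) * S1n L lam2 - (V - 1) / 4 else (1 - lam2 / 4) * S2n L lam2 - S1n L lam2 / 4
  4 * (Sj - g1 ^ j) - 2 * (1 - ε) * (Cj - g1 ^ j * (1 - ε)) + 2 * (2 * ε - ε ^ 2) * g1 ^ j - 2 * (Cj - g1 ^ j)

/-- ★ the named value of `Σ_{k ∈ T′} P.eval (g(k), g(k′), E(k), E(k′))`. -/
noncomputable def PairCoef.red (P : PairCoef) : ℝ :=
  let V : ℝ := (L : ℝ) ^ 2
  let g1 := gres L lam2 (K1 L)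
  P.a00 * (V - 2) + (P.a10 + P.a01) * (S1n L lam2 - g1) + (P.a20 + P.a02) * (S2n L lam2 - g1 ^ 2) + P.a11 * T10n L lam2
    + (P.a30 + P.a03) * (S3n L lam2 - g1 ^ 3) + P.a21 * G21n L lam2 + P.a12 * G12n L lam2
    + (P.b0 + P.c0) * (4 * V - 2 * eps1 L) + (P.b1 + P.c1) * serJ L lam2 1 + (P.b2 + P.c2) * serJ L lam2 2

/-! ## The remaining table entries over `T′` -/

omit [NeZero L] in
/-- `ε(K₁) = ε₁` (`L ≥ 2`). -/
theorem epsT_K1 (hL : 2 ≤ L) : epsT L (K1 L) = eps1 L := by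
  have : Fact (1 < L) := ⟨by omega⟩
  unfold epsT eps1 K1
  simp only [ZMod.val_one, ZMod.val_zero, Nat.cast_one, Nat.cast_zero, mul_zero, zero_div, Real.cos_zero, mul_one]
  ring

/-- `E(0) = 0`, `E(−K₁) = E(K₁) = 2ε₁`. -/
theorem EK_special (hL : 2 ≤ L) : EK L 0 = 0 ∧ EK L (-K1 L) = 2 * eps1 L ∧ EK L (K1 L) = 2 * eps1 L := by
  unfold EK
  rw [epsT_zero, epsT_neg, epsT_K1 L hL]
  exact ⟨by ring, rfl, rfl⟩

/-- the reflection `k ↦ −k − K₁` preserves sums over `T′`. -/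
theorem sum_torPrime_reflect (hL : 2 ≤ L) (F : Tor L → ℝ) :
    ∑ k ∈ torPrime L, F (-k - K1 L) = ∑ k ∈ torPrime L, F k := by
  rw [ClosedExp.sum_torPrime L hL, ClosedExp.sum_torPrime L hL]
  have h : ∑ k : Tor L, F (-k - K1 L) = ∑ k : Tor L, F k := by
    refine Fintype.sum_equiv ((Equiv.neg (Tor L)).trans (Equiv.subRight (K1 L))) _ _ fun k => ?_
    simp
  rw [h, neg_zero, zero_sub, neg_neg, sub_self]
  ring

/-- the constant, the cubes, `g′²`, `gg′²` and the energy sums over `T′`. -/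
theorem sum_torPrime_more (hlam : 0 < lam2) (h1 : lam2 < eps1 L) (a : ℝ) :
    (∑ _k ∈ torPrime L, a) = a * ((L : ℝ) ^ 2 - 2) ∧
    (∑ k ∈ torPrime L, gres L lam2 (k + K1 L) ^ 2) = S2n L lam2 - gres L lam2 (K1 L) ^ 2 ∧
    (∑ k ∈ torPrime L, gres L lam2 k ^ 3) = S3n L lam2 - gres L lam2 (K1 L) ^ 3 ∧
    (∑ k ∈ torPrime L, gres L lam2 (k + K1 L) ^ 3) = S3n L lam2 - gres L lam2 (K1 L) ^ 3 ∧
    (∑ k ∈ torPrime L, gres L lam2 k * gres L lam2 (k + K1 L) ^ 2) = G12n L lam2 ∧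
    (∑ k ∈ torPrime L, EK L k) = 4 * (L : ℝ) ^ 2 - 2 * eps1 L ∧
    (∑ k ∈ torPrime L, EK L (k + K1 L)) = 4 * (L : ℝ) ^ 2 - 2 * eps1 L := by
  have hL := ClosedExp.two_le_of_pos_lt_eps1 L hlam h1
  obtain ⟨e0, em, _⟩ := EK_special L hL
  refine ⟨?_, ?_, ?_, ?_, ?_, ?_, ?_⟩
  · rw [ClosedExp.sum_torPrime L hL, ClosedExp.sum_univ_const]; ring
  · rw [ClosedExp.sum_torPrime L hL, ClosedExp.sum_shift_K1 L (fun k => gres L lam2 k ^ 2), S2n_eq, zero_add, neg_add_cancel,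
      ClosedExp.gres_zero]; ring
  · rw [ClosedExp.sum_torPrime L hL, S3n_eq, ClosedExp.gres_zero, B1.gres_neg]; ring
  · rw [ClosedExp.sum_torPrime L hL, ClosedExp.sum_shift_K1 L (fun k => gres L lam2 k ^ 3), S3n_eq, zero_add, neg_add_cancel,
      ClosedExp.gres_zero]; ring
  · rw [ClosedExp.sum_torPrime L hL, ClosedExp.G12n_eq, ClosedExp.gres_zero, neg_add_cancel, ClosedExp.gres_zero]; ring
  · rw [ClosedExp.torPrime_eq, Finset.sum_erase_eq_sub (Finset.mem_erase.2 ⟨neg_ne_zero.2 (K1_ne_zero L hL), Finset.mem_univ _⟩),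
      ClosedExp.sum_erase_zero_EK L hL, em]
  · rw [ClosedExp.sum_torPrime L hL, ClosedExp.sum_shift_K1 L (fun k => EK L k), zero_add, neg_add_cancel, e0,
      ← ClosedExp.sum_erase_zero_EK L hL, ClosedExp.sum_erase_zero L (fun k => EK L k), e0, (EK_special L hL).2.2]
    ring

/-- ★ the shifted-energy sums `Σ_{T′} g′^jE = Σ_{T′} g^jE′ = serJ j`, `j = 1, 2`. -/
theorem sum_torPrime_ser (hlam : 0 < lam2) (h1 : lam2 < eps1 L) :
    (∑ k ∈ torPrime L, EK L k * gres L lam2 (k + K1 L)) = serJ L lam2 1 ∧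
    (∑ k ∈ torPrime L, EK L k * gres L lam2 (k + K1 L) ^ 2) = serJ L lam2 2 ∧
    (∑ k ∈ torPrime L, EK L (k + K1 L) * gres L lam2 k) = serJ L lam2 1 ∧
    (∑ k ∈ torPrime L, EK L (k + K1 L) * gres L lam2 k ^ 2) = serJ L lam2 2 := by
  have hL := ClosedExp.two_le_of_pos_lt_eps1 L hlam h1
  have hne : ∀ k : Tor L, k ≠ 0 → 2 * epsT L k - lam2 ≠ 0 := fun k hk => (ClosedExp.two_epsT_sub_pos' L hlam h1 k hk).ne'
  obtain ⟨hs1, hs2⟩ := shiftedEnergyReduction_holds L lam2 hne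
  obtain ⟨hc1, hc2, _, _⟩ := cosWeightedReduction_holds L lam2 hne
  have hcos : Real.cos (2 * Real.pi / L) = 1 - eps1 L := by unfold eps1; ring
  have hsin : Real.sin (2 * Real.pi / L) ^ 2 = 2 * eps1 L - eps1 L ^ 2 := by
    have := Real.sin_sq_add_cos_sq (2 * Real.pi / L)
    rw [hcos] at this; linarith
  have e1 : (∑ k ∈ torPrime L, EK L k * gres L lam2 (k + K1 L)) = serJ L lam2 1 := by
    rw [show (∑ k ∈ torPrime L, EK L k * gres L lam2 (k + K1 L)) = ∑ k ∈ torPrime L, gres L lam2 (k + K1 L) * EK L k from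
      Finset.sum_congr rfl fun k _ => mul_comm _ _, hs1, hc1, hcos, hsin]
    unfold serJ
    simp only [if_true, pow_one]
  have e2 : (∑ k ∈ torPrime L, EK L k * gres L lam2 (k + K1 L) ^ 2) = serJ L lam2 2 := by
    rw [show (∑ k ∈ torPrime L, EK L k * gres L lam2 (k + K1 L) ^ 2) = ∑ k ∈ torPrime L, gres L lam2 (k + K1 L) ^ 2 * EK L k from
      Finset.sum_congr rfl fun k _ => mul_comm _ _, hs2, hc2, hcos, hsin]
    unfold serJ
    simp only [show (2 : ℕ) ≠ 1 by norm_num, if_false]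
  refine ⟨e1, e2, ?_, ?_⟩
  · rw [← e1, ← sum_torPrime_reflect L hL (fun k => EK L (k + K1 L) * gres L lam2 k)]
    refine Finset.sum_congr rfl fun k _ => ?_
    rw [show -k - K1 L + K1 L = -k by ring, show -k - K1 L = -(k + K1 L) by ring, B1.gres_neg]
    unfold EK; rw [epsT_neg]
  · rw [← e2, ← sum_torPrime_reflect L hL (fun k => EK L (k + K1 L) * gres L lam2 k ^ 2)]
    refine Finset.sum_congr rfl fun k _ => ?_
    rw [show -k - K1 L + K1 L = -k by ring, show -k - K1 L = -(k + K1 L) by ring, B1.gres_neg]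
    unfold EK; rw [epsT_neg]

/-! ## ★ The generic reduction -/

/-- ★★ `Σ_{k ∈ T′} P.eval (g(k), g(k + x̂), E(k), E(k + x̂)) = P.red` for `0 < λ₂ < ε₁`. -/
theorem sum_torPrime_pairCoef (P : PairCoef) (hlam : 0 < lam2) (h1 : lam2 < eps1 L) :
    ∑ k ∈ torPrime L, P.eval (gres L lam2 k) (gres L lam2 (k + K1 L)) (EK L k) (EK L (k + K1 L)) = P.red L lam2 := by
  have hL := ClosedExp.two_le_of_pos_lt_eps1 L hlam h1
  obtain ⟨t21, t20, t11, t10, t01⟩ := sum_torPrime_basic L lam2 hL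
  obtain ⟨tc, t02, t30, t03, t12, tE, tE'⟩ := sum_torPrime_more L lam2 hlam h1 P.a00
  obtain ⟨s1, s2, s1', s2'⟩ := sum_torPrime_ser L lam2 hlam h1
  simp only [PairCoef.eval, Finset.sum_add_distrib, ← Finset.mul_sum]
  rw [tc, t10, t01, t20, t11, t02, t30, t21, t12, t03, tE, s1, s2, tE', s1', s2']
  unfold PairCoef.red
  ring

end Summit.HubbardSuperconductivity.HubbardSuperconductivity.Theorems.AnisotropyChord.Transfer.Fibre3.L2.N1
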